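import Summits.BirchSwinnertonDyer.BirchSwinnertonDyer.Theorems.GenusKolyvaginAtTwoGenusPrimitiveSupplyAtTwoPrimeTwistRealPlace
import HarnessLib

/-!
# Route `GenusKolyvaginAtTwo`, crux #2 `GenusPrimitiveSupplyAtTwo` (stmt-BirchSwinnertonDyer-22136):
# THE NORM CORE of the prime-twist dictionary — «norms from `F(√d)` are doubles» ⟹ `H¹_f(F) ∩ H¹_𝒜(F) = 0`

Width seat `bsd-line-gk2-p5` g14 (cell `bsd-f1-sign2`, SUPPLY lineage of crux 22136), file 37 of the series; sequel of file 35 (`…PrimeTwistRealPlace`,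
the cocycle template) and of gk2-p4's `…TwoTranspositionOfDictionary` (T-2q from the displayed one-place dictionary `hdict`). THEOREMS ONLY
(no definition, no named fact, no `sorry`); helper `--supports stmt-BirchSwinnertonDyer-22136`; no item is closed; BSD is not proved.

WHAT (Kramer 1981 Prop. 3 / Mazur–Rubin 2010 Lemma 2.11 in prime-twist currency, `p = 2`).
* §160 `res_eq_zero_of_mem_of_mem_of_norm_two` — THE COCYCLE CORE over any `K`-field `F`: if `d ∉ F²`, `χ|_{Γ_F}` cuts out `F(ι√d)`,
  `τ₀` flips `ι√d`, and every point `A ∈ E(F̄)` fixed by the stabiliser of `ι√d` has `A + τ₀A = 2N` with `N ∈ E(F̄)^{Γ_F}` («norms from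
  `F(√d)` are doubles»), then a class in BOTH `E`'s Kummer condition and `A_χ`'s `𝔓`-Selmer condition at `F` restricts to `0` in
  `H¹(F, E[2])`: `c|_{Γ_F} = ∂Q = ∂^χ(R, −R)` ⟹ `A = Q + R` is fixed by the stabiliser, `τ₀A = Q − R`, `2Q = A + τ₀A = 2N`, `T = Q − N ∈ E[2]`
  and `c|_{Γ_F} = ∂T`.
* §161 `forall_exists_two_nsmul_of_hasGoodReductionAt_of_not_mem_maxUnramified` — THE NORM INPUT at a finite place `v ∤ 2` of good
  reduction RAMIFIED in `K(√d)` (`ι√d ∉ K_v^{nr}`): `N E(K_v(ι√d)) = 2 E(K_v)` — Kramer's `normSubgroup_eq_map_range_two_ramified` (PROVED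
  in the tree, `Kramer1981/RamifiedOddGoodNormIndexProofs`) on a unit-discriminant model, transported along the substitution and to geometric points
  (files 31/38's bridges).
* §162 `res_eq_zero_of_mem_selmerLocalKer_of_mem_primeTwist_selmerLocalKer_ramified` — THE RAMIFIED BRICK (`K`-general).
* (sequel `…PrimeTwistRamifiedRat`: over `ℚ`, gk2-p4's displayed `hdict` at the door primes of a two-transposition-admissible `(d, q₀, q₁)` and
  T-2q `TwoTranspositionTwistLawAtTwo` by name.)

Honest framing: KNOWN in print (Kramer 1981 Prop. 3; MR 2010 Lemma 2.11 / Lemma 3.2 / Prop. 3.3; Poonen–Rains Thm. 4.14; KMR 2014 Prop. 47 (ii));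
kernel-new; beyond-print theorem: no. Crux 22136 stays OPEN exactly at (U) 24947 ∧ (CONV₂) 19220/24948. BSD is not proved by any of this.

References: [Kramer1981] Prop. 3 (p. 125), Prop. 7; [MazurRubin2010] Lemma 2.11, Lemma 3.2, Prop. 3.3; [MazurRubin2007] Prop. 5.2;
[PoonenRains2012] Thm. 4.14; [KlagsbrunMazurRubin2014] Prop. 47 (ii).
-/

set_option linter.dupNamespace false -- tree convention: `Summit.BirchSwinnertonDyer.BirchSwinnertonDyer.Theorems` (summit = sub-problem)
set_option autoImplicit false

noncomputable section

open scoped Classical ValuativeRel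

namespace Summit.BirchSwinnertonDyer.BirchSwinnertonDyer.Theorems.GenusKolyArch

open WeierstrassCurve Field NumberField IsDedekindDomain Function
open Literature.NumberTheory.EllipticCurves Literature.NumberTheory.GaloisRepresentations
open Literature.NumberTheory.GaloisCohomology
open Literature.NumberTheory.GaloisRepresentations.IsNonarchimedeanLocalField (maxUnramified)
open Literature.NumberTheory.EllipticCurves.PrimeTwist (ResPoints points localChar localModule locMap constEmb mem_points_iff
  coe_locMap_constEmb_apply)
open Summit.BirchSwinnertonDyer.Rank1Residual.X11b.KummerPT (kummerStrict kummerRelaxed)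
open Summit.BirchSwinnertonDyer.Rank1Residual.F1Sign2

universe u

/-! ## §160 The cocycle core: «norms are doubles» ⟹ `H¹_f(F) ∩ H¹_𝒜(F)` restricts to `0` -/

section Core

variable {K : Type} [Field K] [NumberField K] (W : WeierstrassCurve K) [W.IsElliptic] {d : K}
variable (χ : absoluteGaloisGroup K →ₜ* Multiplicative (ZMod 2)) (F : Type) [Field F] [Algebra K F]

/-- **The cocycle core of Kramer's Prop. 7 / MR's `H¹_f ∩ H¹_f^χ = δ(N E(F(√d)))` in prime-twist currency.** `F` any `K`-field, `d ∉ F²`,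
`χ|_{Γ_F}` the character of `F(ι√d)`, `τ₀ ∈ Γ_F` flipping `ι√d`; IF every `A ∈ E(F̄)` fixed by the stabiliser of `ι√d` has `A + τ₀A = N + N` with `N`
fixed by `Γ_F`, THEN a class of `H¹(K, E[2])` in `E`'s Kummer condition and in `A_χ`'s `𝔓`-Selmer condition at `F` restricts to `0` in
`H¹(F, E[2])`. [cite: Kramer1981, Prop. 7] [cite: MazurRubin2007, Prop. 5.2] [cite: MazurRubin2010, Lemma 2.11] -/
theorem res_eq_zero_of_mem_of_mem_of_norm_two (hd : ∀ s : F, s ^ 2 ≠ algebraMap K F d)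
    (hχα : ∀ τ : absoluteGaloisGroup F, χ (resGal (K := K) F τ) = 1 ↔
      (show AlgebraicClosure F ≃ₐ[F] AlgebraicClosure F from τ) (closureEmb (K := K) F (geomSqrt d)) = closureEmb (K := K) F (geomSqrt d))
    {τ₀ : absoluteGaloisGroup F}
    (hτ₀ : (show AlgebraicClosure F ≃ₐ[F] AlgebraicClosure F from τ₀) (closureEmb (K := K) F (geomSqrt d)) = -closureEmb (K := K) F (geomSqrt d))
    (hnorm2 : ∀ A : localPoints W F,
      (∀ g : absoluteGaloisGroup F,
        (show AlgebraicClosure F ≃ₐ[F] AlgebraicClosure F from g) (closureEmb (K := K) F (geomSqrt d)) = closureEmb (K := K) F (geomSqrt d) →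
          g • A = A) →
      ∃ N : localPoints W F, (∀ g : absoluteGaloisGroup F, g • N = N) ∧ A + τ₀ • A = N + N)
    {c : W.galH1Torsion ((2 : ℕ) : ℤ)} (hW : c ∈ W.selmerLocalKer F 2) (hA : c ∈ PrimeTwist.selmerLocalKer W χ F) :
    galoisCohomology.res (W.torsionGaloisModule ((2 : ℕ) : ℤ)) F 1 c = 0 := by
  haveI : CharZero F := charZero_of_injective_algebraMap (algebraMap K F).injective
  set α := closureEmb (K := K) F (geomSqrt d) with hαdef
  have hα0 : α ≠ 0 := by
    intro h0
    apply hd 0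
    have h' := closureEmb_geomSqrt_sq_eq_algebraMap_field (K := K) (d := d) F
    rw [← hαdef, h0, zero_pow two_ne_zero, eq_comm, map_eq_zero] at h'
    rw [h', zero_pow two_ne_zero]
  have hsq : ∀ τ : absoluteGaloisGroup F,
      (show AlgebraicClosure F ≃ₐ[F] AlgebraicClosure F from τ) α = α ∨
        (show AlgebraicClosure F ≃ₐ[F] AlgebraicClosure F from τ) α = -α := fun τ ↦ by
    have h2 : ((show AlgebraicClosure F ≃ₐ[F] AlgebraicClosure F from τ) α) ^ 2 = α ^ 2 := by
      rw [← map_pow, hαdef, closureEmb_geomSqrt_sq_eq_algebraMap_field F, AlgEquiv.commutes]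
    exact sq_eq_sq_iff_eq_or_eq_neg.mp h2
  have hne : (show AlgebraicClosure F ≃ₐ[F] AlgebraicClosure F from τ₀) α ≠ α := by
    intro h
    have h' := hτ₀
    rw [h] at h'
    have h2 : α + α = 0 := by nth_rw 2 [h']; exact add_neg_cancel α
    rw [← two_mul, mul_eq_zero, or_iff_right (two_ne_zero)] at h2
    exact hα0 h2
  -- the two bounding cochains
  obtain ⟨φ, rfl⟩ := oneCocycleClass_surjective
    (discreteTopRep (absoluteGaloisGroup K) (W.geomTorsion ((2 : ℕ) : ℤ))) c
  obtain ⟨Q, hQ⟩ := (oneCocycleClass_mem_resKer_iff _ _ _ φ).mp hW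
  obtain ⟨f, hf⟩ := (oneCocycleClass_mem_resKer_iff _ _ _ φ).mp hA
  set cτ : absoluteGaloisGroup F → localPoints W F :=
    fun τ ↦ pointsMap W F ((φ.1 (resGal (K := K) F τ) : W.geomTorsion ((2 : ℕ) : ℤ)) : W.geomPoints) with hcτ
  have hcQ : ∀ τ, cτ τ = τ • Q - Q := fun τ ↦ by
    rw [← hQ τ, AddMonoidHom.comp_apply, AddSubgroup.coe_subtype]
  have hc2 : ∀ τ, cτ τ + cτ τ = 0 := fun τ ↦ by
    rw [hcτ, ← two_nsmul, ← map_nsmul, ← AddSubgroupClass.coe_nsmul, AddSubgroup.torsionBy.nsmul,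
      AddSubgroup.coe_zero, map_zero]
  set R : localPoints W F := (f : ResPoints (localChar χ F) (localPoints W F)) 0 with hRdef
  have hR1 : (f : ResPoints (localChar χ F) (localPoints W F)) 1 = -R := by
    have h := (mem_points_iff (localChar χ F) (localPoints W F) _).mp f.2
    change ∑ i : Fin 2, (f : ResPoints (localChar χ F) (localPoints W F)) i = 0 at h
    rw [Fin.sum_univ_two] at h
    exact eq_neg_of_add_eq_zero_right h
  have hcoord : ∀ τ : absoluteGaloisGroup F,
      cτ τ = τ • (f : ResPoints (localChar χ F) (localPoints W F)) (0 - ResPoints.expo (localChar χ F) τ) - R := by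
    intro τ
    have h := congrArg (fun g : localModule W χ F ↦ (g : ResPoints (localChar χ F) (localPoints W F)) 0) (hf τ)
    simp only at h
    rw [coe_locMap_constEmb_apply, AddSubgroupClass.coe_sub, PrimeTwist.ResPoints.sub_apply, PrimeTwist.points.coe_smul,
      PrimeTwist.ResPoints.smul_apply'] at h
    exact h
  have hfixR : ∀ τ : absoluteGaloisGroup F, (show AlgebraicClosure F ≃ₐ[F] AlgebraicClosure F from τ) α = α → cτ τ = τ • R - R := by
    intro τ hτ
    rw [hcoord τ, (expo_localChar_eq_of_iff χ hχα τ).1 hτ, sub_zero]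
  have hflipR : cτ τ₀ = -(τ₀ • R) - R := by
    rw [hcoord τ₀, (expo_localChar_eq_of_iff χ hχα τ₀).2 hne, show (0 : ZMod 2) - 1 = 1 by decide, hR1, smul_neg]
  -- `A = Q + R` is fixed by the stabiliser and `τ₀A = Q − R`
  have hAfix : ∀ g : absoluteGaloisGroup F, (show AlgebraicClosure F ≃ₐ[F] AlgebraicClosure F from g) α = α → g • (Q + R) = Q + R := by
    intro g hg
    have h1 : g • Q = Q + cτ g := by rw [hcQ]; abel
    have h2 : g • R = R + cτ g := by rw [hfixR g hg]; abel
    rw [smul_add, h1, h2, show Q + cτ g + (R + cτ g) = Q + R + (cτ g + cτ g) by abel, hc2 g, add_zero]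
  have hτ₀Q : τ₀ • Q = Q + cτ τ₀ := by rw [hcQ]; abel
  have hτ₀R : τ₀ • R = -R - cτ τ₀ := by rw [hflipR]; abel
  have hτ₀A : τ₀ • (Q + R) = Q - R := by rw [smul_add, hτ₀Q, hτ₀R]; abel
  obtain ⟨N, hNfix, hN⟩ := hnorm2 (Q + R) hAfix
  have hNN : N + N = Q + Q := by
    rw [← hN, hτ₀A]; abel
  -- `T = Q − N ∈ E[2]` bounds `c|_{Γ_F}` inside `E[2]`
  set T : localPoints W F := Q - N with hTdef
  have hT2 : ((2 : ℕ) : ℤ) • T = 0 := by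
    rw [Nat.cast_ofNat, two_zsmul, hTdef]
    calc Q - N + (Q - N) = (Q + Q) - (N + N) := by abel
      _ = 0 := by rw [hNN, sub_self]
  have hn : ((2 : ℕ) : ℤ) ≠ 0 := by norm_num
  have hTmem : T ∈ AddSubgroup.torsionBy (localPoints W F) ((2 : ℕ) : ℤ) := by
    change ((2 : ℕ) : ℤ) • T = 0
    exact hT2
  set T₀ : W.geomTorsion ((2 : ℕ) : ℤ) := (W.torsionPointsEquiv ((2 : ℕ) : ℤ) (E := F) hn).symm ⟨T, hTmem⟩ with hT₀def
  have hT₀ : (W.torsionPointsEquiv ((2 : ℕ) : ℤ) (E := F) hn) T₀ = ⟨T, hTmem⟩ := by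
    rw [hT₀def, AddEquiv.apply_symm_apply]
  have key : ∀ g : absoluteGaloisGroup F, φ.1 (resGal (K := K) F g) = resGal (K := K) F g • T₀ - T₀ := by
    intro g
    apply (W.torsionPointsEquiv ((2 : ℕ) : ℤ) (E := F) hn).injective
    rw [map_sub, torsionPointsEquiv_smul, hT₀]
    apply Subtype.ext
    rw [coe_torsionPointsEquiv_apply, AddSubgroupClass.coe_sub, AddSubgroup.torsionBy.coe_smul]
    change cτ g = g • T - T
    rw [hcQ g, hTdef, smul_sub, hNfix g]
    abel
  rw [WeierstrassCurve.res_torsionGaloisModule_oneCocycleClass]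
  exact (oneCocycleClass_eq_zero_iff _ _).mpr ⟨T₀, fun g ↦ key g⟩

omit [NumberField K] [W.IsElliptic] in
/-- `d ∉ F²` as soon as `ι√d` lies outside a subfield of `F̄` containing `F` (e.g. `ι√d ∉ F^{nr}`). [folklore] -/
theorem forall_sq_ne_of_closureEmb_geomSqrt_not_mem (L : IntermediateField F (AlgebraicClosure F))
    (hα : closureEmb (K := K) F (geomSqrt d) ∉ L) : ∀ s : F, s ^ 2 ≠ algebraMap K F d := by
  intro s hs
  apply hα
  have h2 : (closureEmb (K := K) F (geomSqrt d)) ^ 2 = (algebraMap F (AlgebraicClosure F) s) ^ 2 := by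
    rw [closureEmb_geomSqrt_sq_eq_algebraMap_field F, ← map_pow, hs]
  rcases sq_eq_sq_iff_eq_or_eq_neg.mp h2 with h | h
  · rw [h]; exact L.algebraMap_mem s
  · rw [h]; exact neg_mem (L.algebraMap_mem s)

end Core

end Summit.BirchSwinnertonDyer.BirchSwinnertonDyer.Theorems.GenusKolyArch

end
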